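import Summits.Ventures.PercRepro.C041MultiExitHang

/-!
# ROW C-041 — THE MULTI-EXIT ATTACHMENT: its zone sets at the anchor (p6, gen 33; mine-3's C-041.md §20 (c)
BLOCK MAPS with `r` exits)

Setting of `C041MultiExitHang`: `hang Z₁ u Z a`, the unmarked multigraph `Z₁` (anchor `a₁`) with the zone `Z k`
hung at the exit `u k` for every `k : ι`.  With the STATUSES of an exit under the colouring `ω = col₁ σ` — merged
`Z₁.Mg a₁ (u k) ω` (blue-connected to the anchor), reached `Z₁.Rd a₁ (u k) ω` (red-connected) — and the BLUE
CONNECTION of two exits `Z₁.Mg (u k) (u l) ω`: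

* **`inl_mem_D_iff`** — a host vertex is deleted iff it is blue-connected to an exit whose zone's anchor is
  deleted; **`anchor_mem_D_iff`** — the anchor is deleted iff some merged exit's zone has its anchor deleted
  (`inl_mem_D2_iff`, `anchor_mem_D2_iff` alike, for the `2`-marks);
* **`inr_mem_D_iff`** — a zone vertex is deleted iff it is not the stray vertex and is deleted in its zone, or its
  junction is deleted and it lies in the anchor's blue component of its zone;
* **`adm_iff`** — every zone admissible, and no two blue-connected exits (possibly equal) carry a blue `2`-mark
  reaching one anchor and a blue `1`-mark reaching the other;
* **`blueK_iff`** — every reached exit's zone is blue at its own `K`.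

Every statement is read off the reach lemmas of `C041MultiExitHang`; the counts over the colourings of `Z₁` are
the next modules (`C041BlockCount`, `C041MultiExitCount`).
-/

namespace PercRepro

namespace ZoneZ

namespace MultiExit

open ZoneData Pendant

variable {ι V₁ E₁ U₁ U₂ : Type} {V E T₁ T₂ : ι → Type}
variable (Z₁ : ZoneData V₁ E₁ U₁ U₂) (u : ι → V₁) (Z : (k : ι) → ZoneData (V k) (E k) (T₁ k) (T₂ k))
  (a : (k : ι) → V k) (c : Bool) (σ : State (E₁ ⊕ (Σ k, E k)) (Σ k, T₁ k) (Σ k, T₂ k)) (a₁ : V₁)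

/-! ## Generic reach facts -/

/-- The reach of a set of the form `{f k | p k}` is the union of the reaches of its members. -/
theorem mem_reach_exists_iff {W κ : Type} (R : W → W → Prop) (f : κ → W) (p : κ → Prop) (x : W) :
    x ∈ reach R {s | ∃ k, s = f k ∧ p k} ↔ ∃ k, p k ∧ x ∈ reach R {f k} := by
  constructor
  · rintro ⟨s, ⟨k, rfl, hk⟩, hsx⟩
    exact ⟨k, hk, f k, rfl, hsx⟩
  · rintro ⟨k, hk, s, hs, hsx⟩
    rw [Set.mem_singleton_iff] at hs
    rw [hs] at hsx
    exact ⟨f k, ⟨k, rfl, hk⟩, hsx⟩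

/-- Blue connectivity inside `Z₁`, as a reach: `v` is blue-connected to `k`. -/
theorem mem_reach_iff_Mg (ω : E₁ → Bool) (k v : V₁) : v ∈ reach (cAdj Z₁ false ω) {k} ↔ Z₁.Mg k v ω := Iff.rfl

/-- Red connectivity inside `Z₁`, as a reach: `v` is red-connected to `k`. -/
theorem mem_reach_iff_Rd (ω : E₁ → Bool) (k v : V₁) : v ∈ reach (cAdj Z₁ true ω) {k} ↔ Z₁.Rd k v ω := Iff.rfl

/-- Blue connectivity is reflexive. -/
theorem Mg_refl (ω : E₁ → Bool) (v : V₁) : Z₁.Mg v v ω := mem_reach_of_mem rfl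

/-! ## The reach of a mark set of the attachment -/

/-- The host sources of a mark set of the attachment: the exits whose zone reaches its anchor from its own marks. -/
theorem hostSrc_markSet {T : ι → Type} (atk : (k : ι) → T k → V k) (m : (Σ k, T k) → Bool) (b : Bool) :
    hostSrc u Z a c σ (markSet (fun t : Σ k, T k => red u a t.1 (atk t.1 t.2)) m b) =
      {v | ∃ k, v = u k ∧ a k ∈ reach (cAdj (Z k) c (st σ k).1) (markSet (atk k) (fun t => m ⟨k, t⟩) b)} := by
  ext v
  simp only [hostSrc, Set.mem_union, Set.mem_setOf_eq]
  have e1 : leftSet (markSet (fun t : Σ k, T k => red u a t.1 (atk t.1 t.2)) m b) =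
      {v | ∃ k, v = u k ∧ a k ∈ markSet (atk k) (fun t => m ⟨k, t⟩) b} := by
    ext v
    exact inl_mem_markSet_hang u a atk m b v
  have e2 : ∀ k, rightSet (markSet (fun t : Σ k, T k => red u a t.1 (atk t.1 t.2)) m b) k =
      {y | y ≠ a k ∧ y ∈ markSet (atk k) (fun t => m ⟨k, t⟩) b} := by
    intro k
    ext y
    exact inr_mem_markSet_hang u a atk m b k y
  rw [e1]
  simp only [Set.mem_setOf_eq, e2]
  constructor
  · rintro (⟨k, rfl, hk⟩ | ⟨k, rfl, hk⟩)
    · exact ⟨k, rfl, mem_reach_of_mem hk⟩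
    · exact ⟨k, rfl, (mem_reach_self_iff_avoid _ _ _).2 (Or.inr hk)⟩
  · rintro ⟨k, rfl, hk⟩
    rcases (mem_reach_self_iff_avoid _ _ _).1 hk with h | h
    · exact Or.inl ⟨k, rfl, h⟩
    · exact Or.inr ⟨k, rfl, h⟩

/-- A host vertex is reached from a mark set iff it is connected inside `Z₁` to an exit whose zone reaches its
anchor from its own marks. -/
theorem inl_mem_reach_markSet_iff {T : ι → Type} (atk : (k : ι) → T k → V k) (m : (Σ k, T k) → Bool) (b : Bool)
    (v : V₁) :
    Sum.inl v ∈ reach (cAdj (hang Z₁ u Z a) c σ.1) (markSet (fun t : Σ k, T k => red u a t.1 (atk t.1 t.2)) m b) ↔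
      ∃ k, a k ∈ reach (cAdj (Z k) c (st σ k).1) (markSet (atk k) (fun t => m ⟨k, t⟩) b) ∧
        v ∈ reach (cAdj Z₁ c (col₁ σ)) {u k} := by
  rw [inl_mem_reach_iff Z₁ u Z a c σ _ (stray_not_mem_markSet_hang u a atk m b), hostSrc_markSet,
    mem_reach_exists_iff]

/-- A zone vertex is reached from a mark set iff it is not the stray vertex and is reached inside its zone from
the zone's own marks, or its junction is reached and it is connected to the anchor inside its zone. -/
theorem inr_mem_reach_markSet_iff {T : ι → Type} (atk : (k : ι) → T k → V k) (m : (Σ k, T k) → Bool) (b : Bool)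
    (k : ι) (x : V k) :
    Sum.inr ⟨k, x⟩ ∈
        reach (cAdj (hang Z₁ u Z a) c σ.1) (markSet (fun t : Σ k, T k => red u a t.1 (atk t.1 t.2)) m b) ↔
      x ≠ a k ∧ (x ∈ reach (cAdj (Z k) c (st σ k).1) (markSet (atk k) (fun t => m ⟨k, t⟩) b) ∨
        (Sum.inl (u k) ∈
            reach (cAdj (hang Z₁ u Z a) c σ.1) (markSet (fun t : Σ k, T k => red u a t.1 (atk t.1 t.2)) m b) ∧
          x ∈ reach (cAdj (Z k) c (st σ k).1) {a k})) := by
  rw [inr_mem_reach_iff Z₁ u Z a c σ _ (stray_not_mem_markSet_hang u a atk m b),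
    ← inl_mem_reach_iff Z₁ u Z a c σ _ (stray_not_mem_markSet_hang u a atk m b)]
  have e2 : rightSet (markSet (fun t : Σ k, T k => red u a t.1 (atk t.1 t.2)) m b) k =
      {y | y ≠ a k ∧ y ∈ markSet (atk k) (fun t => m ⟨k, t⟩) b} := by
    ext y
    exact inr_mem_markSet_hang u a atk m b k y
  rw [e2]
  refine and_congr Iff.rfl ?_
  rw [mem_reach_iff_avoid (cAdj (Z k) c (st σ k).1) (markSet (atk k) (fun t => m ⟨k, t⟩) b) (a k) x]
  constructor
  · rintro (h | ⟨hj, hx⟩)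
    · exact Or.inl (Or.inl h)
    · exact Or.inr ⟨hj, hx⟩
  · rintro ((h | ⟨ha, hx⟩) | ⟨hj, hx⟩)
    · exact Or.inl h
    · refine Or.inr ⟨?_, hx⟩
      rw [inl_mem_reach_iff Z₁ u Z a c σ _ (stray_not_mem_markSet_hang u a atk m b), hostSrc_markSet,
        mem_reach_exists_iff]
      exact ⟨k, ha, mem_reach_of_mem rfl⟩
    · exact Or.inr ⟨hj, hx⟩

/-! ## The deleted vertices -/

/-- **A host vertex is deleted** iff it is blue-connected to an exit whose zone's anchor is deleted. -/
theorem inl_mem_D_iff (v : V₁) :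
    Sum.inl v ∈ (hang Z₁ u Z a).D σ ↔ ∃ k, a k ∈ (Z k).D (st σ k) ∧ Z₁.Mg (u k) v (col₁ σ) :=
  inl_mem_reach_markSet_iff Z₁ u Z a false σ (fun k => (Z k).at₁) σ.2.1 false v

/-- **A host vertex is deleted on side `2`** iff it is blue-connected to an exit whose zone's anchor is. -/
theorem inl_mem_D2_iff (v : V₁) :
    Sum.inl v ∈ (hang Z₁ u Z a).D2 σ ↔ ∃ k, a k ∈ (Z k).D2 (st σ k) ∧ Z₁.Mg (u k) v (col₁ σ) :=
  inl_mem_reach_markSet_iff Z₁ u Z a false σ (fun k => (Z k).at₂) σ.2.2 false v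

/-- **A zone vertex is deleted** iff it is not the stray vertex and is deleted in its zone, or its junction is
deleted and it lies in the anchor's blue component of its zone. -/
theorem inr_mem_D_iff (k : ι) (x : V k) :
    Sum.inr ⟨k, x⟩ ∈ (hang Z₁ u Z a).D σ ↔
      x ≠ a k ∧ (x ∈ (Z k).D (st σ k) ∨ (Sum.inl (u k) ∈ (hang Z₁ u Z a).D σ ∧ x ∈ (Z k).P {a k} (st σ k))) :=
  inr_mem_reach_markSet_iff Z₁ u Z a false σ (fun k => (Z k).at₁) σ.2.1 false k x

/-- **A zone vertex is deleted on side `2`** iff it is not the stray vertex and is so in its zone, or its junction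
is deleted on side `2` and it lies in the anchor's blue component of its zone. -/
theorem inr_mem_D2_iff (k : ι) (x : V k) :
    Sum.inr ⟨k, x⟩ ∈ (hang Z₁ u Z a).D2 σ ↔
      x ≠ a k ∧ (x ∈ (Z k).D2 (st σ k) ∨ (Sum.inl (u k) ∈ (hang Z₁ u Z a).D2 σ ∧ x ∈ (Z k).P {a k} (st σ k))) :=
  inr_mem_reach_markSet_iff Z₁ u Z a false σ (fun k => (Z k).at₂) σ.2.2 false k x

/-- **The anchor is deleted** iff some merged exit's zone has its anchor deleted. -/
theorem anchor_mem_D_iff :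
    Sum.inl a₁ ∈ (hang Z₁ u Z a).D σ ↔ ∃ k, Z₁.Mg a₁ (u k) (col₁ σ) ∧ a k ∈ (Z k).D (st σ k) := by
  rw [inl_mem_D_iff]
  constructor
  · rintro ⟨k, hk, hm⟩
    exact ⟨k, TwoExit.Mg_symm Z₁ _ _ _ hm, hk⟩
  · rintro ⟨k, hm, hk⟩
    exact ⟨k, hk, TwoExit.Mg_symm Z₁ _ _ _ hm⟩

/-- **The anchor is deleted on side `2`** iff some merged exit's zone has its anchor deleted on side `2`. -/
theorem anchor_mem_D2_iff :
    Sum.inl a₁ ∈ (hang Z₁ u Z a).D2 σ ↔ ∃ k, Z₁.Mg a₁ (u k) (col₁ σ) ∧ a k ∈ (Z k).D2 (st σ k) := by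
  rw [inl_mem_D2_iff]
  constructor
  · rintro ⟨k, hk, hm⟩
    exact ⟨k, TwoExit.Mg_symm Z₁ _ _ _ hm, hk⟩
  · rintro ⟨k, hm, hk⟩
    exact ⟨k, hk, TwoExit.Mg_symm Z₁ _ _ _ hm⟩

/-- A junction whose zone's anchor is deleted is deleted. -/
theorem junction_mem_D_of (k : ι) (hk : a k ∈ (Z k).D (st σ k)) : Sum.inl (u k) ∈ (hang Z₁ u Z a).D σ :=
  (inl_mem_D_iff Z₁ u Z a σ (u k)).2 ⟨k, hk, Mg_refl Z₁ _ _⟩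

/-- A junction whose zone's anchor is deleted on side `2` is deleted on side `2`. -/
theorem junction_mem_D2_of (k : ι) (hk : a k ∈ (Z k).D2 (st σ k)) : Sum.inl (u k) ∈ (hang Z₁ u Z a).D2 σ :=
  (inl_mem_D2_iff Z₁ u Z a σ (u k)).2 ⟨k, hk, Mg_refl Z₁ _ _⟩

/-- A vertex of the anchor's blue component of a zone carrying a blue `2`-mark puts the anchor in `D2`. -/
theorem anchor_mem_D2_of_mem_P {W F S₁ S₂ : Type} (Y : ZoneData W F S₁ S₂) (b : W) (τ : State F S₁ S₂) {y : W}
    (hy : y ∈ Y.M τ) (hP : y ∈ Y.P {b} τ) : b ∈ Y.D2 τ :=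
  reach_singleton_subset (mem_reach_of_mem hy) (mem_reach_singleton_symm (adj_symm Y _ τ) hP)

/-! ## Admissibility -/

/-- **Admissibility of the attachment**: every zone admissible, and no two blue-connected exits (possibly equal)
with a blue `2`-mark reaching the anchor of one zone and a blue `1`-mark reaching the anchor of the other. -/
theorem adm_iff :
    (hang Z₁ u Z a).adm σ ↔ (∀ k, (Z k).adm (st σ k)) ∧
      ∀ k l, a k ∈ (Z k).D2 (st σ k) → a l ∈ (Z l).D (st σ l) → ¬ Z₁.Mg (u k) (u l) (col₁ σ) := by
  constructor
  · intro h
    have h' := Set.disjoint_left.1 h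
    refine ⟨fun k => ?_, fun k l hk hl hc => ?_⟩
    · rw [adm, Set.disjoint_left]
      intro y hyM hyD
      by_cases hy : y = a k
      · subst hy
        exact h' ((inl_mem_M_iff Z₁ u Z a σ (u k)).2 ⟨k, rfl, hyM⟩) (junction_mem_D_of Z₁ u Z a σ k hyD)
      · exact h' ((inr_mem_M_iff Z₁ u Z a σ k y).2 ⟨hy, hyM⟩) ((inr_mem_D_iff Z₁ u Z a σ k y).2 ⟨hy, Or.inl hyD⟩)
    · have hD : Sum.inl (u k) ∈ (hang Z₁ u Z a).D σ :=
        (inl_mem_D_iff Z₁ u Z a σ (u k)).2 ⟨l, hl, TwoExit.Mg_symm Z₁ _ _ _ hc⟩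
      exact (hang Z₁ u Z a).not_mem_D_of_mem_D2 _ σ h (junction_mem_D2_of Z₁ u Z a σ k hk) hD
  · rintro ⟨hadm, hpair⟩
    rw [adm, Set.disjoint_left]
    rintro w hwM hwD
    rcases w with v | ⟨k, y⟩
    · obtain ⟨k, rfl, hk⟩ := (inl_mem_M_iff Z₁ u Z a σ v).1 hwM
      obtain ⟨l, hl, hc⟩ := (inl_mem_D_iff Z₁ u Z a σ (u k)).1 hwD
      exact hpair k l (mem_reach_of_mem hk) hl (TwoExit.Mg_symm Z₁ _ _ _ hc)
    · obtain ⟨hy, hyM⟩ := (inr_mem_M_iff Z₁ u Z a σ k y).1 hwM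
      obtain ⟨-, hyD | ⟨hj, hP⟩⟩ := (inr_mem_D_iff Z₁ u Z a σ k y).1 hwD
      · exact Set.disjoint_left.1 (hadm k) hyM hyD
      · obtain ⟨l, hl, hc⟩ := (inl_mem_D_iff Z₁ u Z a σ (u k)).1 hj
        exact hpair k l (anchor_mem_D2_of_mem_P (Z k) (a k) (st σ k) hyM hP) hl (TwoExit.Mg_symm Z₁ _ _ _ hc)

/-! ## The red reach of the anchor and «blue at `K`» -/

/-- A host vertex lies in the red reach of the anchor iff it is red-connected to it inside `Z₁`. -/
theorem inl_mem_K_iff (v : V₁) :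
    Sum.inl v ∈ (hang Z₁ u Z a).K {Sum.inl a₁} σ ↔ Z₁.Rd a₁ v (col₁ σ) :=
  inl_mem_reach_singleton_iff Z₁ u Z a true σ a₁ v

/-- A zone vertex lies in the red reach of the anchor iff it is not the stray vertex, its exit is reached and it
lies in the red reach of its zone's anchor. -/
theorem inr_mem_K_iff (k : ι) (x : V k) :
    Sum.inr ⟨k, x⟩ ∈ (hang Z₁ u Z a).K {Sum.inl a₁} σ ↔
      x ≠ a k ∧ (Z₁.Rd a₁ (u k) (col₁ σ) ∧ x ∈ (Z k).K {a k} (st σ k)) :=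
  inr_mem_reach_singleton_iff Z₁ u Z a true σ a₁ k x

/-- **Blue at `K` at the anchor**: every reached exit's zone is blue at its own `K`. -/
theorem blueK_iff :
    (hang Z₁ u Z a).blueK {Sum.inl a₁} σ ↔ ∀ k, Z₁.Rd a₁ (u k) (col₁ σ) → (Z k).blueK {a k} (st σ k) := by
  constructor
  · intro h k hr
    have h' := Set.disjoint_left.1 h
    rw [blueK, Set.disjoint_left]
    intro y hyK hyM
    by_cases hy : y = a k
    · subst hy
      refine h' ((inl_mem_K_iff Z₁ u Z a σ a₁ (u k)).2 hr) ?_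
      rcases hyM with hm | hm
      · exact Or.inl ((inl_mem_Blt_iff Z₁ u Z a σ (u k)).2 ⟨k, rfl, hm⟩)
      · exact Or.inr ((inl_mem_Mt_iff Z₁ u Z a σ (u k)).2 ⟨k, rfl, hm⟩)
    · refine h' ((inr_mem_K_iff Z₁ u Z a σ a₁ k y).2 ⟨hy, hr, hyK⟩) ?_
      rcases hyM with hm | hm
      · exact Or.inl ((inr_mem_Blt_iff Z₁ u Z a σ k y).2 ⟨hy, hm⟩)
      · exact Or.inr ((inr_mem_Mt_iff Z₁ u Z a σ k y).2 ⟨hy, hm⟩)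
  · intro h
    rw [blueK, Set.disjoint_left]
    rintro w hwK hwM
    rcases w with v | ⟨k, y⟩
    · have hr := (inl_mem_K_iff Z₁ u Z a σ a₁ v).1 hwK
      rcases hwM with hm | hm
      · obtain ⟨k, rfl, hk⟩ := (inl_mem_Blt_iff Z₁ u Z a σ v).1 hm
        exact Set.disjoint_left.1 (h k hr) (mem_reach_of_mem rfl) (Or.inl hk)
      · obtain ⟨k, rfl, hk⟩ := (inl_mem_Mt_iff Z₁ u Z a σ v).1 hm
        exact Set.disjoint_left.1 (h k hr) (mem_reach_of_mem rfl) (Or.inr hk)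
    · obtain ⟨hy, hr, hyK⟩ := (inr_mem_K_iff Z₁ u Z a σ a₁ k y).1 hwK
      rcases hwM with hm | hm
      · exact Set.disjoint_left.1 (h k hr) hyK (Or.inl ((inr_mem_Blt_iff Z₁ u Z a σ k y).1 hm).2)
      · exact Set.disjoint_left.1 (h k hr) hyK (Or.inr ((inr_mem_Mt_iff Z₁ u Z a σ k y).1 hm).2)

end MultiExit

end ZoneZ

end PercRepro
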